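import Literature.AnabelianGeometry.AbsoluteAnabelian.MLFGaloisTFGProofs
import Literature.AnabelianGeometry.AbsoluteAnabelian.AbsTopIThm26iiStarProofs
import Literature.AnabelianGeometry.AbsoluteAnabelian.AbsTopIThm26iiProSigmaProofs
import Literature.AnabelianGeometry.AbsoluteAnabelian.GaloisSubextensionProofs
import Summits.BirchSwinnertonDyer.Rank1Residual.GaloisImage.LocalEulerPoincareCharacteristicHolds
import HarnessLib

/-!
# `G_k` is topologically finitely generated (`k/ℚ_p` finite) — UNCONDITIONAL
# (abc-iut GAP-LEDGER row G-L4t4-2; [AbsTopI] Thm 2.6 (ii) input, [NSW] Thm 7.5.10)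

Cell `abc-iut` (run/shared/lean/pub/abc-iut/), layer L4, DAG node AbsTopI:Thm2.6(ii) (CONE):
the printed proof of [AbsTopI] Thm 2.6 (ii) (p. 23 l. 11–13) uses "the topological finite
generation … of `G` [cf. [NSW], Theorem 7.5.10]", typed as the hypothesis
`IsTopologicallyFinitelyGenerated (absoluteGaloisGroup K)` of
`Literature.AnabelianGeometry.AbsoluteAnabelian.FundamentalExtension.thm26ii_of_starCondition`
(and of `lemma114_ii_reduction_of_rank_of_tfg`).  The Literature file `MLFGaloisTFGProofs.lean`
proves it modulo the tree's named fact `localEulerPoincareCharacteristic` (Tate's local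
Euler–Poincaré characteristic), which is PROVED in the tree but Summits-side
(`localEulerPoincareCharacteristic_holds`, cell `b2b-bsdres`); a Literature file may not import a
Summits file, so the unconditional statement is assembled HERE:

* `isTopologicallyFinitelyGenerated_absoluteGaloisGroup_local` — valued form (`F` a
  non-archimedean local field of characteristic `0`);
* `isTopologicallyFinitelyGenerated_absoluteGaloisGroup_padic` — the `ℚ_p`-binder form wanted by
  GAP row G-L4t4-2, verbatim: `∀ p K [Algebra ℚ_[p] K] [FiniteDimensional ℚ_[p] K],
  IsTopologicallyFinitelyGenerated (absoluteGaloisGroup K)`;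
* `FundamentalExtension.isTopologicallyFinitelyGenerated_gal_of_mlfBase` — transported along the
  base datum `G ≅ G_K` of an extension; and the consumer
  `FundamentalExtension.thm26ii_of_starCondition'` / `thm26ii_of_starCondition_of_isProSet'` =
  abc-iut-L4-t4's `thm26ii_of_starCondition` / `thm26ii_of_starCondition_of_isProSet` ([AbsTopI]
  Thm 2.6 (ii), DAG node AbsTopI:Thm2.6(ii), cases `Σ ⊇ Primes` / `Δ` pro-`Σ`) with the hypothesis
  `hG` DISCHARGED (remaining printed inputs: Prop 2.2 `E.GeomTFG`, the splitting over an open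
  subgroup, condition (∗), and `Δ` pro-`Σ` in the second).

Route (NOT the cited Jannsen–Wingberg structure theorem; an independent argument establishing OUR
typed predicate): Gaschütz lifting along a chief series of each finite quotient (solvable),
Tate's Euler–Poincaré characteristic + local duality for the uniform bound
`#H¹(F, M) ≤ |M|^{c_F+2}`, and compactness.  HONEST FRAMING: classical; nothing here asserts
anything about abc or takes a side on [IUTchIII] Cor. 3.12; typed ≠ proved except the named decls.

## References

* J. Neukirch, A. Schmidt, K. Wingberg, *Cohomology of Number Fields* (2008), Thm. 7.5.10.
  [NeukirchSchmidtWingberg2008]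
* S. Mochizuki, *Topics in Absolute Anabelian Geometry I* (2012), Thm 2.6 (ii), proof p. 23.
  [MochizukiAbsTopI2012]
-/

noncomputable section

namespace Summit.ABC.IUTFork

open Field Literature.AnabelianGeometry.AbsoluteAnabelian Literature.NumberTheory.GaloisRepresentations

/-- **`Γ_F` is topologically finitely generated** for every non-archimedean local field `F` of
characteristic `0` — unconditional (Tate's Euler–Poincaré characteristic supplied by the tree's
`localEulerPoincareCharacteristic_holds`). [cite: NeukirchSchmidtWingberg2008, Thm. 7.5.10] -/
theorem isTopologicallyFinitelyGenerated_absoluteGaloisGroup_local (F : Type) [Field F]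
    [ValuativeRel F] [TopologicalSpace F] [IsNonarchimedeanLocalField F] [CharZero F] :
    IsTopologicallyFinitelyGenerated (absoluteGaloisGroup F) :=
  isTopologicallyFinitelyGenerated_absoluteGaloisGroup_of_localEPC F
    (localEulerPoincareCharacteristic_holds F)

/-- **`G_k` is topologically finitely generated for every finite extension `k/ℚ_p`** — the
statement of abc-iut GAP-LEDGER row G-L4t4-2 ([AbsTopI] Thm 2.6 (ii) proof input "[NSW] Theorem
7.5.10"), unconditional. [cite: NeukirchSchmidtWingberg2008, Thm. 7.5.10]
[cite: MochizukiAbsTopI2012, Thm 2.6 (ii) proof p.23] -/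
theorem isTopologicallyFinitelyGenerated_absoluteGaloisGroup_padic (p : ℕ) [Fact p.Prime]
    (K : Type) [Field K] [Algebra ℚ_[p] K] [FiniteDimensional ℚ_[p] K] :
    IsTopologicallyFinitelyGenerated (absoluteGaloisGroup K) :=
  isTopologicallyFinitelyGenerated_absoluteGaloisGroup_padic_of_localEPC
    (fun F _ _ _ _ _ => localEulerPoincareCharacteristic_holds F) p K

/-- The base group `G` of an extension with MLF base data `G ≅ G_K` is topologically finitely
generated (transport of `isTopologicallyFinitelyGenerated_absoluteGaloisGroup_padic` along the
datum `B.galIso`). [cite: NeukirchSchmidtWingberg2008, Thm. 7.5.10] -/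
theorem _root_.Literature.AnabelianGeometry.AbsoluteAnabelian.FundamentalExtension.isTopologicallyFinitelyGenerated_gal_of_mlfBase
    {E : FundamentalExtension.{0}} (B : E.MLFBase) : IsTopologicallyFinitelyGenerated E.gal :=
  (isTopologicallyFinitelyGenerated_absoluteGaloisGroup_padic B.p B.K).of_continuousMulEquiv
    B.galIso.symm

/-- **[AbsTopI] Thm 2.6 (ii)** (abc-iut-L4-t4's `thm26ii_of_starCondition`, DAG node
AbsTopI:Thm2.6(ii)) with the hypothesis "`G` topologically finitely generated ([NSW] Thm 7.5.10)"
DISCHARGED: for every extension `1 → Δ → Π → G → 1` with MLF base data, GIVEN Prop 2.2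
(`E.GeomTFG`), a splitting over an open subgroup of `G` and condition (∗), the predicate
`E.Thm26ii B S` holds for every `S ⊇ Primes`. [cite: MochizukiAbsTopI2012, Thm 2.6 (ii) p.21] -/
theorem _root_.Literature.AnabelianGeometry.AbsoluteAnabelian.FundamentalExtension.thm26ii_of_starCondition'
    {E : FundamentalExtension.{0}} (B : E.MLFBase) (S : Set ℕ) (hS : ∀ l : ℕ, l.Prime → l ∈ S)
    (hΔ : E.GeomTFG) (hs : E.SplitsOverOpenSubgroup) (hstar : E.StarCondition) : E.Thm26ii B S :=
  FundamentalExtension.thm26ii_of_starCondition B S hS hΔ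
    (FundamentalExtension.isTopologicallyFinitelyGenerated_gal_of_mlfBase B) hs hstar

/-- **[AbsTopI] Thm 2.6 (ii), general `Σ` with `Δ` pro-`Σ`** (abc-iut-L4-t4's
`thm26ii_of_starCondition_of_isProSet`) with the hypothesis "`G` topologically finitely generated"
DISCHARGED. [cite: MochizukiAbsTopI2012, Thm 2.6 (ii) p.21] -/
theorem _root_.Literature.AnabelianGeometry.AbsoluteAnabelian.FundamentalExtension.thm26ii_of_starCondition_of_isProSet'
    {E : FundamentalExtension.{0}} (B : E.MLFBase) (S : Set ℕ) (hΔ : E.GeomTFG)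
    (hpro : IsProSet E.geom S) (hs : E.SplitsOverOpenSubgroup) (hstar : E.StarCondition) :
    E.Thm26ii B S :=
  FundamentalExtension.thm26ii_of_starCondition_of_isProSet B S hΔ
    (FundamentalExtension.isTopologicallyFinitelyGenerated_gal_of_mlfBase B) hpro hs hstar

end Summit.ABC.IUTFork

end
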